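import Summits.QuantumFields.YangMills.Theorems.SmallCircleAnchorAnchorGapFrozenWellPosed

/-!
# Crux `AnchorGap` (stmt-QuantumFields-11141), line `registered` — around stub P (`stub_pinningTransfer`)

Stub P of the birth skeleton `Cruxes/AnchorGap/Lines/birth.lean` asks: frozen-holonomy torus
clustering (stub S) ⟹ along some schedule `E ≥ ε₁` the soft `E(β)V`-pinned theory clusters
uniformly in `L`. As typed its antecedent is bare torus clustering of ONE reference theory with
unknown constants — not known to be stable under `E = ∞ ↦ E < ∞`; and at every finite `E` the
holonomy leaves every fixed neighbourhood of `Cl(g₀)` with positive probability per site (`V` is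
continuous, real-valued), so for large `L` sparse large-field defects are present and even robust
frozen clustering does not transfer softly. The honest soft part of the cut is recorded here:

* `exists_pinningStrength` — the schedule: for `E ≥ E₀(U₀, ε₀)` the factor `e^{-E V}` puts at most
  the fraction `ε₀` of its Haar mass outside any open `U₀ ⊇ Cl(g₀)` (compactness + Haar charges
  opens);
* `pinningTransfer_of_annealedGap` — the CORRECTED stub P: if the pinned theory clusters
  uniformly over all `(U₀(β), ε₀(β))`-concentrated class-function pinnings (the *annealed
  near-class holonomy gap*, which at `ε₀ → 0` is the frozen theory after axial gauge and a
  time-independent rotation), then the crux body holds for `V` along `E(β) := max ε₁ (E₀ β)`;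
* `soft_cov_abs_le_two`, `soft_clustering_of_large_separation` — well-posedness of the soft
  pinned functional exactly as it appears in the crux body: the weight
  `exp (act U − E Σ_x V (P_x U))` is continuous, hence measurable, and pinched between two positive
  constants, so `Ex` is an honest normalised expectation, every covariance of two `Loc` observables
  is `≤ 2`, and the clustering bound need only be proved for separations `n > w` (the abstract
  ratio-expectation layer is imported from `SmallCircleAnchorAnchorGapFrozenWellPosed`).
-/

set_option autoImplicit false

noncomputable section

namespace Summit.QuantumFields.YangMills.Theorems.AnchorGap

open MeasureTheory
open Literature.MathematicalPhysics.QuantumFieldTheory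

/-- **The pinning schedule exists (soft).** Let `μ` be a probability measure on a compact space
`G` charging open sets, `V : G → ℝ` continuous with `V g₀ ≤ V` and `V g = V g₀` only on the
conjugates of `g₀`, and `U₀` an open set containing all conjugates of `g₀`. Then for every
`ε₀ > 0` there is `E₀ ≥ 0` such that for all `E ≥ E₀` the Boltzmann factor `e^{-E V}` puts at
most the fraction `ε₀` of its `μ`-mass outside `U₀`:
`∫_{U₀ᶜ} e^{-E V} dμ ≤ ε₀ ∫ e^{-E V} dμ`. Proof: off `U₀` (compact) `V ≥ V g₀ + η` with `η > 0`
(the minimum is attained and is not a conjugate of `g₀`), while the open set `{V < V g₀ + η/2} ∋ g₀`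
has mass `v > 0`; so the ratio is `≤ e^{-E η / 2} / v ≤ ε₀` once `E ≥ (2/η) |log (ε₀ v)|`. [folklore] -/
theorem exists_pinningStrength {G : Type*} [Group G] [TopologicalSpace G] [CompactSpace G]
    [MeasurableSpace G] [OpensMeasurableSpace G] (μ : Measure G) [IsProbabilityMeasure μ]
    [μ.IsOpenPosMeasure] {V : G → ℝ} {g₀ : G} (hVc : Continuous V) (hmin : ∀ g, V g₀ ≤ V g)
    (huniq : ∀ g, V g = V g₀ → ∃ a : G, g = a * g₀ * a⁻¹) {U₀ : Set G} (hU₀ : IsOpen U₀)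
    (hg₀ : ∀ a : G, a * g₀ * a⁻¹ ∈ U₀) {ε₀ : ℝ} (hε₀ : 0 < ε₀) :
    ∃ E₀ : ℝ, 0 ≤ E₀ ∧ ∀ E : ℝ, E₀ ≤ E →
      ∫ g in U₀ᶜ, Real.exp (-(E * V g)) ∂μ ≤ ε₀ * ∫ g, Real.exp (-(E * V g)) ∂μ := by
  -- integrability of the Boltzmann factor (bounded by `exp (-(E * V g₀))` when `0 ≤ E`)
  have hmeas : ∀ E : ℝ, Measurable fun g => Real.exp (-(E * V g)) := fun E =>
    (Real.continuous_exp.comp ((continuous_const.mul hVc).neg)).measurable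
  have hbd : ∀ E : ℝ, 0 ≤ E → ∀ g, Real.exp (-(E * V g)) ≤ Real.exp (-(E * V g₀)) := by
    intro E hE g
    exact Real.exp_le_exp.2 (neg_le_neg (mul_le_mul_of_nonneg_left (hmin g) hE))
  have hint : ∀ E : ℝ, 0 ≤ E → Integrable (fun g => Real.exp (-(E * V g))) μ := by
    intro E hE
    refine (integrable_const (Real.exp (-(E * V g₀)))).mono' (hmeas E).aestronglyMeasurable
      (Filter.Eventually.of_forall fun g => ?_)
    rw [Real.norm_eq_abs, abs_of_pos (Real.exp_pos _)]
    exact hbd E hE g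
  by_cases hK : (U₀ᶜ : Set G).Nonempty
  swap
  · refine ⟨0, le_rfl, fun E hE => ?_⟩
    rw [Set.not_nonempty_iff_eq_empty.1 hK, Measure.restrict_empty, integral_zero_measure]
    exact mul_nonneg hε₀.le (integral_nonneg fun g => (Real.exp_pos _).le)
  -- the minimum of `V` off `U₀` is strictly above `V g₀`
  have hKc : IsCompact (U₀ᶜ : Set G) := hU₀.isClosed_compl.isCompact
  obtain ⟨k, hkK, hk⟩ := hKc.exists_isMinOn hK hVc.continuousOn
  have hη : 0 < V k - V g₀ := by
    rcases (hmin k).lt_or_eq with h | h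
    · linarith
    · exfalso
      obtain ⟨a, rfl⟩ := huniq k h.symm
      exact hkK (hg₀ a)
  set η : ℝ := V k - V g₀ with hηdef
  -- the open set where `V < V g₀ + η / 2` has positive mass
  set O : Set G := V ⁻¹' Set.Iio (V g₀ + η / 2) with hO
  have hOo : IsOpen O := hVc.isOpen_preimage _ isOpen_Iio
  have hg₀O : g₀ ∈ O := by
    show V g₀ ∈ Set.Iio (V g₀ + η / 2)
    exact Set.mem_Iio.2 (by linarith)
  have hvpos : 0 < μ.real O := by
    rw [Measure.real, ENNReal.toReal_pos_iff]
    exact ⟨hOo.measure_pos μ ⟨g₀, hg₀O⟩, measure_lt_top μ O⟩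
  set v : ℝ := μ.real O with hv
  refine ⟨2 / η * |Real.log (ε₀ * v)|, by positivity, fun E hE => ?_⟩
  have hE0 : 0 ≤ E := le_trans (by positivity) hE
  -- numerator: `∫_{U₀ᶜ} e^{-E V} ≤ e^{-E (V g₀ + η)}`
  have hnum : ∫ g in U₀ᶜ, Real.exp (-(E * V g)) ∂μ ≤ Real.exp (-(E * (V g₀ + η))) := by
    calc ∫ g in U₀ᶜ, Real.exp (-(E * V g)) ∂μ
        ≤ ∫ g in U₀ᶜ, Real.exp (-(E * (V g₀ + η))) ∂μ := by
          refine setIntegral_mono_on (hint E hE0).integrableOn integrableOn_const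
            hU₀.isClosed_compl.measurableSet fun g hg => ?_
          refine Real.exp_le_exp.2 (neg_le_neg (mul_le_mul_of_nonneg_left ?_ hE0))
          have := hk hg
          simp only [Set.mem_setOf_eq] at this
          linarith
      _ = Real.exp (-(E * (V g₀ + η))) * μ.real U₀ᶜ := by
          rw [setIntegral_const, smul_eq_mul, mul_comm]
      _ ≤ Real.exp (-(E * (V g₀ + η))) * 1 := by
          gcongr
          exact measureReal_le_one (μ := μ)
      _ = _ := mul_one _
  -- denominator: `v e^{-E (V g₀ + η/2)} ≤ ∫ e^{-E V}`
  have hden : v * Real.exp (-(E * (V g₀ + η / 2))) ≤ ∫ g, Real.exp (-(E * V g)) ∂μ := by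
    calc v * Real.exp (-(E * (V g₀ + η / 2)))
        = ∫ g in O, Real.exp (-(E * (V g₀ + η / 2))) ∂μ := by
          rw [setIntegral_const, smul_eq_mul, hv]
      _ ≤ ∫ g in O, Real.exp (-(E * V g)) ∂μ := by
          refine setIntegral_mono_on integrableOn_const (hint E hE0).integrableOn
            hOo.measurableSet fun g hg => ?_
          refine Real.exp_le_exp.2 (neg_le_neg (mul_le_mul_of_nonneg_left ?_ hE0))
          exact (Set.mem_Iio.1 hg).le
      _ ≤ ∫ g, Real.exp (-(E * V g)) ∂μ :=
          setIntegral_le_integral (hint E hE0) (Filter.Eventually.of_forall fun g => (Real.exp_pos _).le)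
  -- the choice of `E`
  have hkey : Real.exp (-(E * (V g₀ + η))) ≤ ε₀ * (v * Real.exp (-(E * (V g₀ + η / 2)))) := by
    have h1 : Real.exp (-(E * η / 2)) ≤ ε₀ * v := by
      have hlog : -(E * η / 2) ≤ Real.log (ε₀ * v) := by
        have h2 : 2 / η * |Real.log (ε₀ * v)| * η / 2 = |Real.log (ε₀ * v)| := by
          field_simp
        have h3 : |Real.log (ε₀ * v)| ≤ E * η / 2 := by
          calc |Real.log (ε₀ * v)| = 2 / η * |Real.log (ε₀ * v)| * η / 2 := h2.symm
            _ ≤ E * η / 2 := by gcongr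
        linarith [neg_abs_le (Real.log (ε₀ * v))]
      calc Real.exp (-(E * η / 2)) ≤ Real.exp (Real.log (ε₀ * v)) := Real.exp_le_exp.2 hlog
        _ = ε₀ * v := Real.exp_log (mul_pos hε₀ hvpos)
    calc Real.exp (-(E * (V g₀ + η))) = Real.exp (-(E * η / 2)) * Real.exp (-(E * (V g₀ + η / 2))) := by
          rw [← Real.exp_add]; congr 1; ring
      _ ≤ (ε₀ * v) * Real.exp (-(E * (V g₀ + η / 2))) := by gcongr
      _ = _ := by ring
  calc ∫ g in U₀ᶜ, Real.exp (-(E * V g)) ∂μ ≤ Real.exp (-(E * (V g₀ + η))) := hnum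
    _ ≤ ε₀ * (v * Real.exp (-(E * (V g₀ + η / 2)))) := hkey
    _ ≤ ε₀ * ∫ g, Real.exp (-(E * V g)) ∂μ := by gcongr

/-- **Pinning transfer from the ANNEALED near-class holonomy gap (corrected form of stub P of
line `registered` of crux `AnchorGap`).** For every compact simple `G`, faithful unitary `r`,
abelianising deformation `V` minimised exactly on `Cl(g₀)` (`C_G(g₀)` abelian) and every `T ≥ 1`:
IF (antecedent, the *annealed near-class holonomy gap* at `(r, g₀, T)`) there is `β₀` such that for
every `β ≥ β₀` there are an open set `U₀ ⊇ Cl(g₀)` and a defect tolerance `ε₀ > 0` such that for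
EVERY continuous class function `υ` minimised exactly on `Cl(g₀)` and every strength `s ≥ 0` whose
Boltzmann factor is `(U₀, ε₀)`-concentrated, `∫_{U₀ᶜ} e^{-s υ} dHaar ≤ ε₀ ∫ e^{-s υ} dHaar`, the
`s υ`-pinned finite-temperature Wilson theory on `ℤ_T × (ℤ/L)³` (verbatim the inline functional
of the crux with `E β ↦ s`, `V ↦ υ`) clusters exponentially in space uniformly in `L`, THEN for
every threshold `ε₁` there is a schedule `E ≥ ε₁` along which the `E(β)V`-pinned theory clusters
uniformly in `L` for all `β ≥ β₀` (verbatim the body of `AnchorGap` for this `V`). Proof: by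
`exists_pinningStrength` choose `E₀(β)` making `e^{-E V}` `(U₀(β), ε₀(β))`-concentrated for
`E ≥ E₀(β)` and set `E(β) := max ε₁ (E₀ β)`; instantiate the antecedent at `υ := V`,
`s := E β`. [folklore] -/
theorem pinningTransfer_of_annealedGap :
    ∀ (G : Type) [Group G] [TopologicalSpace G] [IsTopologicalGroup G] [CompactSpace G], IsCompactSimpleLieGroup G → letI : MeasurableSpace G := borel G; haveI : BorelSpace G := ⟨rfl⟩; ∀ (r : LatticeRep G) (V : G → ℝ) (g₀ : G), Continuous V → (∀ a g : G, V (a * g * a⁻¹) = V g) → (∀ g : G, V g₀ ≤ V g) → (∀ g : G, V g = V g₀ → ∃ a : G, g = a * g₀ * a⁻¹) → (∀ a b : G, a * g₀ = g₀ * a → b * g₀ = g₀ * b → a * b = b * a) → ∀ (T : ℕ) [NeZero T], (∃ β₀ : ℝ, ∀ β : ℝ, β₀ ≤ β → ∃ U₀ : Set G, IsOpen U₀ ∧ (∀ a : G, a * g₀ * a⁻¹ ∈ U₀) ∧ ∃ ε₀ : ℝ, 0 < ε₀ ∧ ∀ (υ : G → ℝ) (s : ℝ), Continuous υ → (∀ a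 g : G, υ (a * g * a⁻¹) = υ g) → (∀ g : G, υ g₀ ≤ υ g) → (∀ g : G, υ g = υ g₀ → ∃ a : G, g = a * g₀ * a⁻¹) → 0 ≤ s → ∫ g in U₀ᶜ, Real.exp (-(s * υ g)) ∂haarProbability G ≤ ε₀ * ∫ g, Real.exp (-(s * υ g)) ∂haarProbability G → ∃ m : ℝ, 0 < m ∧ ∀ w : ℕ, ∃ C : ℝ, ∀ (L : ℕ) [NeZero L], let St := ZMod T × (Fin 3 → ZMod L); let Cfg := St × Option (Fin 3) → G; let ν : MeasureTheory.Measure Cfg := MeasureTheory.Measure.pi fun _ => haarProbability G; let sh : St → Option (Fin 3) → St := fun x μ => Option.elim μ (x.1 + 1, x.2) fun i => (x.1, x.2 + Pi.single i 1); let pl : Cfg → St → Option (Fin 3) → Option (Fin 3) → G := fun U x μ κ => U (x, μ) * U (sh x μ, κ) * (U (sh x κ, μ))⁻¹ * (U (x, κ))⁻¹; let act : Cfg → ℝ := fun U => β * ∑ x : St, ∑ i : Fin 3, (r.ρ (pl U x none (some i))).trace.re + β * ∑ x : St, ∑ q : {q : Fin 3 × Fin 3 // q.1 < q.2}, (r.ρ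 (pl U x (some q.1.1) (some q.1.2))).trace.re; let P : Cfg → (Fin 3 → ZMod L) → G := fun U x => (List.ofFn fun t : Fin T => U ((((t : ℕ) : ZMod T), x), none)).prod; let wgt : Cfg → ℝ := fun U => Real.exp (act U - s * ∑ x : Fin 3 → ZMod L, υ (P U x)); let Ex : (Cfg → ℝ) → ℝ := fun F => (∫ U, F U * wgt U ∂ν) / (∫ U, wgt U ∂ν); let σ : ℕ → Cfg → Cfg := fun n U p => U ((p.1.1, p.1.2 + Pi.single 0 (n : ZMod L)), p.2); ∀ (c : Fin 3 → ZMod L), let Loc := fun F : Cfg → ℝ => Measurable F ∧ (∀ U, |F U| ≤ 1) ∧ ∀ U U', (∀ p, (∀ i : Fin 3, (p.1.2 i - c i).val ≤ w) → U p = U' p) → F U = F U'; ∀ F₁ F₂ : Cfg → ℝ, Loc F₁ → Loc F₂ → ∀ n : ℕ, 2 * n < L → |Ex (fun U => F₁ U * F₂ (σ n U)) - Ex F₁ * Ex (fun U => F₂ (σ n U))| ≤ C * Real.exp (-(m * n))) → ∀ ε₁ : ℝ, ∃ E : ℝ → ℝ, (∀ β : ℝ, ε₁ ≤ E β) ∧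 ∃ β₀ : ℝ, ∀ β : ℝ, β₀ ≤ β → ∃ m : ℝ, 0 < m ∧ ∀ w : ℕ, ∃ C : ℝ, ∀ (L : ℕ) [NeZero L], let St := ZMod T × (Fin 3 → ZMod L); let Cfg := St × Option (Fin 3) → G; let ν : MeasureTheory.Measure Cfg := MeasureTheory.Measure.pi fun _ => haarProbability G; let sh : St → Option (Fin 3) → St := fun x μ => Option.elim μ (x.1 + 1, x.2) fun i => (x.1, x.2 + Pi.single i 1); let pl : Cfg → St → Option (Fin 3) → Option (Fin 3) → G := fun U x μ κ => U (x, μ) * U (sh x μ, κ) * (U (sh x κ, μ))⁻¹ * (U (x, κ))⁻¹; let act : Cfg → ℝ := fun U => β * ∑ x : St, ∑ i : Fin 3, (r.ρ (pl U x none (some i))).trace.re + β * ∑ x : St, ∑ q : {q : Fin 3 × Fin 3 // q.1 < q.2}, (r.ρ (pl U x (some q.1.1) (some q.1.2))).trace.re; let P : Cfg → (Fin 3 → ZMod L) → G := fun U x => (List.ofFn fun t : Fin T => U ((((t : ℕ) : ZMod T), x), none)).prod; let wgt : Cfg → ℝ := fun U => Real.exp (act U - E β * ∑ x : Fin 3 →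 ZMod L, V (P U x)); let Ex : (Cfg → ℝ) → ℝ := fun F => (∫ U, F U * wgt U ∂ν) / (∫ U, wgt U ∂ν); let σ : ℕ → Cfg → Cfg := fun n U p => U ((p.1.1, p.1.2 + Pi.single 0 (n : ZMod L)), p.2); ∀ (c : Fin 3 → ZMod L), let Loc := fun F : Cfg → ℝ => Measurable F ∧ (∀ U, |F U| ≤ 1) ∧ ∀ U U', (∀ p, (∀ i : Fin 3, (p.1.2 i - c i).val ≤ w) → U p = U' p) → F U = F U'; ∀ F₁ F₂ : Cfg → ℝ, Loc F₁ → Loc F₂ → ∀ n : ℕ, 2 * n < L → |Ex (fun U => F₁ U * F₂ (σ n U)) - Ex F₁ * Ex (fun U => F₂ (σ n U))| ≤ C * Real.exp (-(m * n)) := by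
  intro G _ _ _ _ hG
  letI : MeasurableSpace G := borel G
  haveI : BorelSpace G := ⟨rfl⟩
  intro r V g₀ hVc hVcl hmin huniq hab T _ hS ε₁
  classical
  haveI : (haarProbability G).IsOpenPosMeasure := by
    rw [haarProbability]; infer_instance
  obtain ⟨β₀, hβ⟩ := hS
  choose U₀ hU₀o hU₀g ε₀ hε₀ H using hβ
  have sched : ∀ β : ℝ, ∃ E₀ : ℝ, 0 ≤ E₀ ∧ ∀ (hb : β₀ ≤ β) (E' : ℝ), E₀ ≤ E' →
      ∫ g in (U₀ β hb)ᶜ, Real.exp (-(E' * V g)) ∂haarProbability G ≤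
        ε₀ β hb * ∫ g, Real.exp (-(E' * V g)) ∂haarProbability G := by
    intro β
    by_cases hb : β₀ ≤ β
    · obtain ⟨E₀, hE₀, h⟩ := exists_pinningStrength (haarProbability G) hVc hmin huniq
        (hU₀o β hb) (hU₀g β hb) (hε₀ β hb)
      exact ⟨E₀, hE₀, fun _ E' hE' => h E' hE'⟩
    · exact ⟨0, le_rfl, fun h => absurd h hb⟩
  choose E₀ hE₀ hsched using sched
  refine ⟨fun β => max ε₁ (E₀ β), fun β => le_max_left _ _, β₀, fun β hb => ?_⟩
  exact H β hb V (max ε₁ (E₀ β)) hVc hVcl hmin huniq ((hE₀ β).trans (le_max_right _ _))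
    (hsched β hb _ (le_max_right _ _))

section SoftWellPosed

/-- **Every covariance of the soft pinned theory is at most `2`** (crux-body vocabulary,
verbatim, with the pinning strength `E β` a free real `s`): for every compact `G` with a
faithful unitary `r`, every continuous `V`, `T ≥ 1`, EVERY real `β` and `s`, every cube side `w`,
every `L ≥ 1`, base point `c`, all `Loc` observables `F₁, F₂` and all separations `n`,
`|Ex (F₁ · F₂∘σ_n) − Ex F₁ · Ex (F₂∘σ_n)| ≤ 2`. Proof: the weight
`exp (act U − s Σ_x V (P_x U))` is continuous (finitely many continuous plaquette traces of a
continuous representation; the Polyakov line is a finite ordered product of link variables; `V`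
is continuous) hence measurable (the configuration space is a finite product of the
second-countable group `G` — `r.ρ` is a closed embedding into matrices), and pinched between
`e^{-B}` and `e^{B}`, `B = |β| (∑_x ∑_i N + ∑_x ∑_{i<j} N) + |s| ∑_x M` with `M = sup |V|`;
apply `ratioEx_cov_abs_le_two` (file `SmallCircleAnchorAnchorGapFrozenWellPosed`) w.r.t. the
product Haar probability measure. [folklore] -/
theorem soft_cov_abs_le_two :
    ∀ (G : Type) [Group G] [TopologicalSpace G] [IsTopologicalGroup G] [CompactSpace G], letI : MeasurableSpace G := borel G; haveI : BorelSpace G := ⟨rfl⟩; ∀ (r : LatticeRep G) (V : G → ℝ), Continuous V → ∀ (T : ℕ) [NeZero T] (β s : ℝ) (w : ℕ) (L : ℕ) [NeZero L], let St := ZMod T × (Fin 3 → ZMod L); let Cfg := St × Option (Fin 3) → G; let ν : MeasureTheory.Measure Cfg := MeasureTheory.Measure.pi fun _ => haarProbability G; let sh : St → Option (Fin 3) → St := fun x μ => Option.elim μ (x.1 + 1, x.2) fun i => (x.1, x.2 + Pi.single i 1); let pl : Cfg → St → Option (Fin 3) → Option (Fin 3) → G := fun U x μ κ => U (x, μ)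 * U (sh x μ, κ) * (U (sh x κ, μ))⁻¹ * (U (x, κ))⁻¹; let act : Cfg → ℝ := fun U => β * ∑ x : St, ∑ i : Fin 3, (r.ρ (pl U x none (some i))).trace.re + β * ∑ x : St, ∑ q : {q : Fin 3 × Fin 3 // q.1 < q.2}, (r.ρ (pl U x (some q.1.1) (some q.1.2))).trace.re; let P : Cfg → (Fin 3 → ZMod L) → G := fun U x => (List.ofFn fun t : Fin T => U ((((t : ℕ) : ZMod T), x), none)).prod; let wgt : Cfg → ℝ := fun U => Real.exp (act U - s * ∑ x : Fin 3 → ZMod L, V (P U x)); let Ex : (Cfg → ℝ) → ℝ := fun F => (∫ U, F U * wgt U ∂ν) / (∫ U, wgt U ∂ν); let σ : ℕ → Cfg → Cfg := fun n U p => U ((p.1.1, p.1.2 + Pi.single 0 (n : ZMod L)), p.2); ∀ (c : Fin 3 → ZMod L), let Loc := fun F : Cfg → ℝ => Measurable F ∧ (∀ U, |F U| ≤ 1) ∧ ∀ U U', (∀ p, (∀ i : Fin 3, (p.1.2 i - c i).val ≤ w) → U p = U' p) → F U = F U'; ∀ F₁ F₂ : Cfg → ℝ, Loc F₁ → Loc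 F₂ → ∀ n : ℕ, |Ex (fun U => F₁ U * F₂ (σ n U)) - Ex F₁ * Ex (fun U => F₂ (σ n U))| ≤ 2 := by
  intro G _ _ _ _
  letI : MeasurableSpace G := borel G
  haveI : BorelSpace G := ⟨rfl⟩
  intro r V hVc T _ β s w L _ St Cfg ν sh pl act P wgt Ex σ c Loc F₁ F₂ hF₁ hF₂ n
  haveI : SecondCountableTopology G :=
    (r.continuous.isClosedEmbedding r.injective).isEmbedding.secondCountableTopology
  haveI : IsProbabilityMeasure ν := by
    show IsProbabilityMeasure (Measure.pi fun _ : St × Option (Fin 3) => haarProbability G)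
    infer_instance
  -- continuity of the action, of the Polyakov lines and of the weight
  have hpl : ∀ (x : St) (μ κ : Option (Fin 3)), Continuous fun U : Cfg => pl U x μ κ := by
    intro x μ κ
    show Continuous fun U : Cfg => U (x, μ) * U (sh x μ, κ) * (U (sh x κ, μ))⁻¹ * (U (x, κ))⁻¹
    exact (((continuous_apply (x, μ)).mul (continuous_apply (sh x μ, κ))).mul
      (continuous_apply (sh x κ, μ)).inv).mul (continuous_apply (x, κ)).inv
  have htr : ∀ (x : St) (μ κ : Option (Fin 3)),
      Continuous fun U : Cfg => (r.ρ (pl U x μ κ)).trace.re := fun x μ κ =>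
    Complex.continuous_re.comp ((r.continuous.comp (hpl x μ κ)).matrix_trace)
  have hact : Continuous act := by
    refine (continuous_const.mul (continuous_finsetSum _ fun x _ =>
      continuous_finsetSum _ fun i _ => htr x none (some i))).add
      (continuous_const.mul (continuous_finsetSum _ fun x _ =>
        continuous_finsetSum _ fun q _ => htr x (some q.1.1) (some q.1.2)))
  have hP : ∀ x : Fin 3 → ZMod L, Continuous fun U : Cfg => P U x := by
    intro x
    show Continuous fun U : Cfg =>
      (List.ofFn fun t : Fin T => U ((((t : ℕ) : ZMod T), x), none)).prod
    simp_rw [List.ofFn_eq_map]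
    exact continuous_list_prod _ fun t _ => continuous_apply _
  have hpin : Continuous fun U : Cfg => s * ∑ x : Fin 3 → ZMod L, V (P U x) :=
    continuous_const.mul (continuous_finsetSum _ fun x _ => hVc.comp (hP x))
  have hwm : Measurable wgt := (Real.continuous_exp.comp (hact.sub hpin)).measurable
  -- two-sided bounds of the weight
  obtain ⟨M, hM⟩ : ∃ M : ℝ, ∀ g : G, |V g| ≤ M := by
    obtain ⟨M, hM⟩ := isCompact_univ.exists_bound_of_continuousOn hVc.continuousOn
    exact ⟨M, fun g => by simpa [Real.norm_eq_abs] using hM g (Set.mem_univ g)⟩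
  set B : ℝ := |β| * ∑ _x : St, ∑ _i : Fin 3, (r.N : ℝ) +
    |β| * ∑ _x : St, ∑ _q : {q : Fin 3 × Fin 3 // q.1 < q.2}, (r.N : ℝ) +
    |s| * ∑ _x : Fin 3 → ZMod L, M with hB
  have hactb : ∀ U : Cfg, |act U - s * ∑ x : Fin 3 → ZMod L, V (P U x)| ≤ B := by
    intro U
    have h1 : |∑ x : St, ∑ i : Fin 3, (r.ρ (pl U x none (some i))).trace.re| ≤
        ∑ _x : St, ∑ _i : Fin 3, (r.N : ℝ) := by
      refine (Finset.abs_sum_le_sum_abs _ _).trans (Finset.sum_le_sum fun x _ => ?_)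
      exact (Finset.abs_sum_le_sum_abs _ _).trans (Finset.sum_le_sum fun i _ =>
        abs_trace_re_le G r _)
    have h2 : |∑ x : St, ∑ q : {q : Fin 3 × Fin 3 // q.1 < q.2},
        (r.ρ (pl U x (some q.1.1) (some q.1.2))).trace.re| ≤
        ∑ _x : St, ∑ _q : {q : Fin 3 × Fin 3 // q.1 < q.2}, (r.N : ℝ) := by
      refine (Finset.abs_sum_le_sum_abs _ _).trans (Finset.sum_le_sum fun x _ => ?_)
      exact (Finset.abs_sum_le_sum_abs _ _).trans (Finset.sum_le_sum fun q _ =>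
        abs_trace_re_le G r _)
    have h3 : |∑ x : Fin 3 → ZMod L, V (P U x)| ≤ ∑ _x : Fin 3 → ZMod L, M :=
      (Finset.abs_sum_le_sum_abs _ _).trans (Finset.sum_le_sum fun x _ => hM _)
    calc |act U - s * ∑ x : Fin 3 → ZMod L, V (P U x)|
        ≤ |act U| + |s * ∑ x : Fin 3 → ZMod L, V (P U x)| := abs_sub _ _
      _ ≤ (|β * ∑ x : St, ∑ i : Fin 3, (r.ρ (pl U x none (some i))).trace.re| +
          |β * ∑ x : St, ∑ q : {q : Fin 3 × Fin 3 // q.1 < q.2},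
            (r.ρ (pl U x (some q.1.1) (some q.1.2))).trace.re|) +
          |s * ∑ x : Fin 3 → ZMod L, V (P U x)| := by
          gcongr
          exact abs_add_le _ _
      _ ≤ B := by
          rw [abs_mul, abs_mul, abs_mul, hB]
          exact add_le_add (add_le_add (mul_le_mul_of_nonneg_left h1 (abs_nonneg β))
            (mul_le_mul_of_nonneg_left h2 (abs_nonneg β)))
            (mul_le_mul_of_nonneg_left h3 (abs_nonneg s))
  have hwa : ∀ U : Cfg, Real.exp (-B) ≤ wgt U := fun U => by
    have h1 := hactb U
    have h2 := neg_abs_le (act U - s * ∑ x : Fin 3 → ZMod L, V (P U x))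
    exact Real.exp_le_exp.2 (by linarith)
  have hwb : ∀ U : Cfg, wgt U ≤ Real.exp B := fun U => by
    have h1 := hactb U
    have h2 := le_abs_self (act U - s * ∑ x : Fin 3 → ZMod L, V (P U x))
    exact Real.exp_le_exp.2 (by linarith)
  -- the observables
  obtain ⟨hF₁m, hF₁b, -⟩ := hF₁
  obtain ⟨hF₂m, hF₂b, -⟩ := hF₂
  have hσ : Measurable (σ n) := measurable_pi_lambda _ fun p => measurable_pi_apply _
  exact ratioEx_cov_abs_le_two ν (Real.exp_pos (-B)) hwm hwa hwb hF₁m hF₁b (hF₂m.comp hσ)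
    fun U => hF₂b (σ n U)

/-- **Soft pinned clustering only needs separations beyond the observable size** (crux-body
vocabulary, verbatim, pinning strength a free real `s`): if, at given `β`, `s`, `m ≥ 0`, `w`, `C`,
`L` and base point `c`, the bound `|Ex (F₁ · F₂∘σ_n) − Ex F₁ · Ex (F₂∘σ_n)| ≤ C e^{−m n}` holds
for all `Loc` observables and all separations `n > w` with `2n < L`, then it holds for ALL `n`
with `2n < L` with the constant `max C (2 e^{m w})` — independent of `L` and `c`, so
volume-uniformity is preserved (`soft_cov_abs_le_two` for `n ≤ w`). [folklore] -/
theorem soft_clustering_of_large_separation :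
    ∀ (G : Type) [Group G] [TopologicalSpace G] [IsTopologicalGroup G] [CompactSpace G], letI : MeasurableSpace G := borel G; haveI : BorelSpace G := ⟨rfl⟩; ∀ (r : LatticeRep G) (V : G → ℝ), Continuous V → ∀ (T : ℕ) [NeZero T] (β s m : ℝ), 0 ≤ m → ∀ (w : ℕ) (C : ℝ) (L : ℕ) [NeZero L], let St := ZMod T × (Fin 3 → ZMod L); let Cfg := St × Option (Fin 3) → G; let ν : MeasureTheory.Measure Cfg := MeasureTheory.Measure.pi fun _ => haarProbability G; let sh : St → Option (Fin 3) → St := fun x μ => Option.elim μ (x.1 + 1, x.2) fun i => (x.1, x.2 + Pi.single i 1); let pl : Cfg → St → Option (Fin 3) → Option (Fin 3) → G := fun U x μ κ => U (x, μ) * U (sh x μ, κ) * (U (sh x κ, μ))⁻¹ * (U (x, κ))⁻¹; let act : Cfg → ℝ := fun U => β * ∑ x : St, ∑ i : Fin 3, (r.ρ (pl U x none (some i))).trace.re + β * ∑ x : St, ∑ q : {q : Fin 3 × Fin 3 // q.1 < q.2}, (r.ρ (pl U x (some q.1.1) (some q.1.2))).trace.re; let P : Cfg → (Fin 3 → ZMod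 L) → G := fun U x => (List.ofFn fun t : Fin T => U ((((t : ℕ) : ZMod T), x), none)).prod; let wgt : Cfg → ℝ := fun U => Real.exp (act U - s * ∑ x : Fin 3 → ZMod L, V (P U x)); let Ex : (Cfg → ℝ) → ℝ := fun F => (∫ U, F U * wgt U ∂ν) / (∫ U, wgt U ∂ν); let σ : ℕ → Cfg → Cfg := fun n U p => U ((p.1.1, p.1.2 + Pi.single 0 (n : ZMod L)), p.2); ∀ (c : Fin 3 → ZMod L), let Loc := fun F : Cfg → ℝ => Measurable F ∧ (∀ U, |F U| ≤ 1) ∧ ∀ U U', (∀ p, (∀ i : Fin 3, (p.1.2 i - c i).val ≤ w) → U p = U' p) → F U = F U'; (∀ F₁ F₂ : Cfg → ℝ, Loc F₁ → Loc F₂ → ∀ n : ℕ, w < n → 2 * n < L → |Ex (fun U => F₁ U * F₂ (σ n U)) - Ex F₁ * Ex (fun U => F₂ (σ n U))| ≤ C * Real.exp (-(m * n))) → ∀ F₁ F₂ : Cfg → ℝ, Loc F₁ → Loc F₂ → ∀ n : ℕ, 2 * n < L → |Ex (fun U => F₁ U * F₂ (σ n U)) - Ex F₁ * Ex (fun U =>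 F₂ (σ n U))| ≤ max C (2 * Real.exp (m * w)) * Real.exp (-(m * n)) := by
  intro G _ _ _ _
  letI : MeasurableSpace G := borel G
  haveI : BorelSpace G := ⟨rfl⟩
  intro r V hVc T _ β s m hm w C L _ St Cfg ν sh pl act P wgt Ex σ c Loc hlarge F₁ F₂ hF₁ hF₂ n hn
  by_cases hwn : w < n
  · calc |Ex (fun U => F₁ U * F₂ (σ n U)) - Ex F₁ * Ex (fun U => F₂ (σ n U))|
          ≤ C * Real.exp (-(m * n)) := hlarge F₁ F₂ hF₁ hF₂ n hwn hn
      _ ≤ max C (2 * Real.exp (m * w)) * Real.exp (-(m * n)) := by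
          gcongr; exact le_max_left _ _
  · have h2 : |Ex (fun U => F₁ U * F₂ (σ n U)) - Ex F₁ * Ex (fun U => F₂ (σ n U))| ≤ 2 :=
      soft_cov_abs_le_two G r V hVc T β s w L c F₁ F₂ hF₁ hF₂ n
    have hnw : n ≤ w := Nat.le_of_not_lt hwn
    have hexp : (1 : ℝ) ≤ Real.exp (m * w) * Real.exp (-(m * n)) := by
      rw [← Real.exp_add]
      refine Real.one_le_exp ?_
      have : (n : ℝ) ≤ w := by exact_mod_cast hnw
      nlinarith
    calc |Ex (fun U => F₁ U * F₂ (σ n U)) - Ex F₁ * Ex (fun U => F₂ (σ n U))| ≤ 2 := h2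
      _ ≤ 2 * (Real.exp (m * w) * Real.exp (-(m * n))) := by nlinarith
      _ = (2 * Real.exp (m * w)) * Real.exp (-(m * n)) := by ring
      _ ≤ max C (2 * Real.exp (m * w)) * Real.exp (-(m * n)) := by
          gcongr; exact le_max_right _ _

end SoftWellPosed

end Summit.QuantumFields.YangMills.Theorems.AnchorGap

end
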